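import Mathlib
import HarnessLib
import Summits.AtomisticToContinuum.FouriersLaw.Theses.JunctionLocality
import Summits.AtomisticToContinuum.FouriersLaw.Theorems.JunctionLocalityConductanceLowerBoundStubKuboLinkAux2
import Summits.AtomisticToContinuum.FouriersLaw.Theorems.JunctionLocalityConductanceLowerBoundStubRowSum
import Summits.AtomisticToContinuum.FouriersLaw.Theorems.OddSectorIrreversibilityResponseDensityLinearResponse
import Summits.AtomisticToContinuum.FouriersLaw.Theorems.OddSectorIrreversibilityResponseDensityKernelContinuity
import Summits.AtomisticToContinuum.FouriersLaw.Theorems.VanishingNoiseTransferVanishingNoiseBoundFlipBondCurrents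
import Summits.AtomisticToContinuum.FouriersLaw.Theorems.BondHeatUncertaintyLinearResponseFTURNessFacts

/-!
# Kubo link of line `ForecastSensitivitySketch`, helper III: the Kubo link from UNIFORM MIXING near
equilibrium (stub `stub_kuboLink`, crux stmt-AtomisticToContinuum-11749; the second conditional form)

For the pinned anharmonic chain `pinnedChain ω₂ lam β γ` (all parameters `> 0`), `T > 0`, along the crux's
unique weak steady-state family `μ` with response coefficient `D_L` at `T`
(`totalCurrent(μ_{L,T+δ/2,T−δ/2})/δ → D_L` along `𝓝[≠] 0`), `L ≥ 2`, `k_b = p_b² − T`, and a classical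
forward field `g` of the left bath (`C² ∩ L²(μ_T)`, mean zero, `L_{T,T} g = −k_0`):

* `stub_kuboLink_of_uniformMixingAt` — **`D_L/(L−1) = γ(1 − (γ/T²)⟨g, k_0⟩_{μ_T})` GIVEN uniform
  exponential mixing of the transition semigroups with baths at `T ± δ/2`, `|δ| < δ₀`** (CEHR 2018 (2.5)
  with `δ`-UNIFORM constants — the binder `hUM` of route `OddSectorIrreversibility`'s
  `responseDensity_conclusion_of_hyps`; an explicit hypothesis, NOT a named fact, NOT in the tree).  Proof:
  energy balance of the weak NESS `totalCurrent(μ_δ) = (L−1)γ(T + δ/2 − ⟨p_0²⟩_δ)` (landed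
  `totalCurrent_eq_left`, no moment hypothesis), so `totalCurrent(μ_δ)/δ = (L−1)γ(1/2 − ⟨k_0⟩_δ/δ)`; the
  landed linear response `⟨k_0⟩_δ/δ → (γ/2T²) Z⁻¹ ∫₀^∞∫ P_s k_0 · e^{−H/T}(p_0² − p_{L−1}²) dx ds`
  (`pinnedChain_linear_response_of_uniformMixing`: exact response identity + `hUM` + the PROVED kernel
  continuity `pinnedChain_tendsto_integral_kernel_temps`); the identification of that functional with
  `⟨g,k_0⟩ − ⟨g,k_{L−1}⟩` (helper II, `oddMomentKubo_eq`); uniqueness of limits along `𝓝[≠] 0`; and the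
  landed row sum `⟨g,k_0⟩ + ⟨g,k_{L−1}⟩ = T²/γ` (`stub_rowSum`):
  `D_L/((L−1)γ) = 1/2 − (γ/2T²)(2⟨g,k_0⟩ − T²/γ) = 1 − (γ/T²)⟨g,k_0⟩`.
* `stub_kuboLink_of_uniformMixing` — the same with the mixing hypothesis quantified over all parameters,
  `T > 0`, `N ≥ 2` (one global statement `UM`) in front of the stub's signature VERBATIM: `UM → stub_kuboLink`.

So, besides route item `ResponseIdentity` (helper I, `stub_kuboLink_of_responseIdentity`), ONE analytic
input closes the stub: `δ`-uniform Harris constants near equilibrium (Hairer–Majda 2010's framework).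
References: Rey-Bellet 2003, Rem. 4.4; Kundu–Dhar–Narayan 2009; Hairer–Majda 2010; CEHR 2018, (2.5).
-/

noncomputable section

open MeasureTheory Filter Topology Set ProbabilityTheory
open scoped ContDiff NNReal ENNReal
open Literature.MathematicalPhysics.KineticTheory.HeatConduction
open Literature.MathematicalPhysics.KineticTheory Literature.Probability.Process OscillatorChain
open Summit.AtomisticToContinuum.FouriersLaw.Theorems
open Summit.AtomisticToContinuum.FouriersLaw.Theorems.SubdiffusiveBondHeat
open Summit.AtomisticToContinuum.FouriersLaw.Theorems.SuperadditiveResistance.DeviceLiouville (kin kin_eq_sq)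
open Summit.AtomisticToContinuum.FouriersLaw.Cruxes.SuperadditiveResistance.FloatingProbeBypassLaplacian

namespace Summit.AtomisticToContinuum.FouriersLaw.Cruxes.ConductanceLowerBound.ForecastSensitivity

/-! ## The Kubo link from uniform mixing near equilibrium -/

section NESS

/-- **The Kubo link from uniform mixing at `(T, L)`** (stub `stub_kuboLink`, second conditional form).
For the pinned anharmonic chain (all parameters `> 0`), `T > 0`, along a weak steady-state family `μ` which
is unique in the class `IsSteadyState`, with response coefficient `D_L` at `T`
(`totalCurrent(μ_{L,T+δ/2,T−δ/2})/δ → D_L` along `𝓝[≠] 0`), `L ≥ 2`: IF the transition semigroups with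
baths at `T ± δ/2`, `|δ| < δ₀`, converge exponentially fast in the `e^{ϑH}`-weighted norm with constants
`C_m, c` INDEPENDENT of `δ` (hypothesis `hUM`; `0 < δ₀ < 2T`, `0 < ϑ < 1/(T + δ₀/2)`, `2ϑ < 1/T`), then for
every classical mean-zero `C² ∩ L²(μ_T)` forward field `g` of the left bath
`D_L/(L−1) = γ(1 − (γ/T²)⟨g, p_0² − T⟩_{μ_T})`.  Proof: energy balance
`totalCurrent(μ_δ) = (L−1)γ(T + δ/2 − ⟨p_0²⟩_δ)` (`totalCurrent_eq_left`), the linear response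
`⟨p_0² − T⟩_δ/δ → (γ/2T²) Z⁻¹ ∫₀^∞∫ P_s k_0 · e^{−H/T}(p_0² − p_{L−1}²)`
(`pinnedChain_linear_response_of_uniformMixing` with the PROVED kernel continuity), the identification
`oddMomentKubo_eq` of that functional with `⟨g,k_0⟩ − ⟨g,k_{L−1}⟩`, uniqueness of limits along `𝓝[≠] 0`,
and the landed row sum `⟨g,k_0⟩ + ⟨g,k_{L−1}⟩ = T²/γ` (`stub_rowSum`). -/
theorem stub_kuboLink_of_uniformMixingAt
    {ω₂ lam β γ : ℝ} (μ : (N : ℕ) → ℝ → ℝ → Measure (PhaseSpace N)) {T : ℝ} (D : ℕ → ℝ)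
    (hω : 0 < ω₂) (hl : 0 < lam) (hβ : 0 < β) (hγ : 0 < γ) (hT : 0 < T)
    (hU : ∀ (N : ℕ) (T_L T_R : ℝ), 0 < T_L → 0 < T_R → ∀ ρ ρ' : Measure (PhaseSpace N),
        (pinnedChain ω₂ lam β γ).IsSteadyState N T_L T_R ρ →
        (pinnedChain ω₂ lam β γ).IsSteadyState N T_L T_R ρ' → ρ = ρ')
    (hμ : ∀ (N : ℕ) (T_L T_R : ℝ), 0 < T_L → 0 < T_R →
        (pinnedChain ω₂ lam β γ).IsSteadyState N T_L T_R (μ N T_L T_R))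
    {L : ℕ} (hL2 : 2 ≤ L)
    (hD : Tendsto (fun δ : ℝ =>
        (pinnedChain ω₂ lam β γ).totalCurrent (μ L (T + δ / 2) (T - δ / 2)) / δ) (𝓝[≠] 0) (𝓝 (D L)))
    {δ₀ ϑ Cm c : ℝ} (hδ₀ : 0 < δ₀) (hδ₀T : δ₀ < 2 * T) (hϑ : 0 < ϑ) (hϑT : ϑ < 1 / (T + δ₀ / 2))
    (h2ϑ : 2 * ϑ < 1 / T) (hCm : 0 ≤ Cm) (hc : 0 < c)
    (hUM : ∀ δ : ℝ, |δ| < δ₀ → ∀ ν : Measure (PhaseSpace L), IsProbabilityMeasure ν →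
      (∀ t : ℝ≥0, ν.bind ((pinnedChain ω₂ lam β γ).transitionKernel L (T + δ / 2) (T - δ / 2) t) = ν) →
      ∀ (z : PhaseSpace L) (t : ℝ≥0) (f : PhaseSpace L → ℝ), Continuous f →
        (∀ y, |f y| ≤ Real.exp (ϑ * (pinnedChain ω₂ lam β γ).hamiltonian L y)) →
        |(∫ y, f y ∂((pinnedChain ω₂ lam β γ).transitionKernel L (T + δ / 2) (T - δ / 2) t z)) -
            ∫ y, f y ∂ν| ≤
          Cm * Real.exp (ϑ * (pinnedChain ω₂ lam β γ).hamiltonian L z) * Real.exp (-c * t))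
    {g : PhaseSpace L → ℝ} (hC : ContDiff ℝ 2 g)
    (hgL2 : MemLp g 2 ((pinnedChain ω₂ lam β γ).gibbsMeasure L T))
    (hmean : ∫ x, g x ∂((pinnedChain ω₂ lam β γ).gibbsMeasure L T) = 0)
    (hpde : ∀ x, (pinnedChain ω₂ lam β γ).generator L T T g x = -(kin L 0 x - T)) :
    D L / ((L : ℝ) - 1) =
      γ * (1 - γ / T ^ 2 * ∫ x, g x * (kin L 0 x - T) ∂((pinnedChain ω₂ lam β γ).gibbsMeasure L T)) := by
  have hL : 0 < L := by omega
  set P := pinnedChain ω₂ lam β γ with hP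
  set μT := P.gibbsMeasure L T with hμT
  haveI : IsProbabilityMeasure μT := pinnedChain_isProbabilityMeasure_gibbsMeasure hω hl.le hβ.le γ L hT
  -- the family near `δ = 0`: probability, kernel-invariant, exponential moments (under (U))
  set μf : ℝ → Measure (PhaseSpace L) := fun δ => μ L (T + δ / 2) (T - δ / 2) with hμf
  have hfacts : ∀ δ : ℝ, |δ| < δ₀ → IsProbabilityMeasure (μf δ) ∧
      (∀ t : ℝ≥0, (μf δ).bind (P.transitionKernel L (T + δ / 2) (T - δ / 2) t) = μf δ) ∧
      (∀ ϑ₁ : ℝ, 0 < ϑ₁ → ϑ₁ < 1 / max (T + δ / 2) (T - δ / 2) →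
        Integrable (fun x => Real.exp (ϑ₁ * P.hamiltonian L x)) (μf δ)) := by
    intro δ hδ
    obtain ⟨hTL, hTR, -⟩ := bath_facts_of_abs_lt hδ₀T hϑT hδ
    obtain ⟨h1, h2, h3, -⟩ :=
      BondHeatUncertainty.ness_facts ω₂ lam β γ hω hl hβ hγ hU μ hμ L hL2 _ _ hTL hTR
    exact ⟨h1, h2, h3⟩
  have hμf0 : μf 0 = μT := by
    show μ L (T + 0 / 2) (T - 0 / 2) = μT
    rw [zero_div, add_zero, sub_zero]
    exact BondHeatUncertainty.ness_eq_gibbsMeasure hω hl hβ hU μ hμ L hT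
  -- the observable `k_0 = p_0² − T`
  set k : PhaseSpace L → ℝ := fun y => y.2 ⟨0, hL⟩ ^ 2 - T with hk
  have hk2 : ContDiff ℝ 2 k := by rw [hk]; fun_prop
  have hkb : ∀ y, |k y| ≤ (2 / ϑ + T) * Real.exp (ϑ * P.hamiltonian L y) := fun y =>
    abs_sq_momentum_sub_le_exp hω hl.le hβ.le hϑ hT.le y ⟨0, hL⟩
  have hk0 : ∫ y, k y ∂μT = 0 := pinnedChain_integral_kinObs_gibbsMeasure hω hl.le hβ.le γ L hT ⟨0, hL⟩
  -- linear response of `⟨k_0⟩_δ` (landed; kernel continuity proved)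
  have hlr := pinnedChain_linear_response_of_uniformMixing hω hl.le hβ hγ hL hT hδ₀ hδ₀T hϑ hϑT hk2 hkb
    hCm hc hUM (pinnedChain_tendsto_integral_kernel_temps hω hl.le hβ.le hγ hL hT hϑ h2ϑ hk2.continuous hkb)
    μf (fun δ hδ => (hfacts δ hδ).1) (fun δ hδ => (hfacts δ hδ).2.1)
  -- the value of the limit functional
  set Z : ℝ := ∫ x, Real.exp (-1 / T * P.hamiltonian L x) with hZ
  have hIθ := integrable_exp_mul_hamiltonian hω hl.le hβ.le γ (N := L) (c := -1 / T)
    (by rw [neg_div]; exact neg_neg_of_pos (one_div_pos.2 hT))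
  have hZ0 : 0 < Z := integral_exp_pos hIθ
  set A : ℝ := ∫ x, g x * (kin L 0 x - T) ∂μT with hA
  set B : ℝ := ∫ x, g x * (kin L (L - 1) x - T) ∂μT with hB
  have hJ := oddMomentKubo_eq hω hl.le hβ hγ hL2 hT hC hgL2 hmean hpde
  rw [hJ] at hlr
  have hlimk : Tendsto (fun δ : ℝ => (∫ y, k y ∂(μf δ)) / δ) (𝓝[≠] 0)
      (𝓝 (γ / (2 * T ^ 2) * (A - B))) := by
    have e1 : (γ / (2 * T ^ 2)) / Z * (Z * (A - B)) = γ / (2 * T ^ 2) * (A - B) := by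
      field_simp
    rw [e1] at hlr
    refine hlr.congr fun δ => ?_
    rw [hμf0, hk0, sub_zero]
  -- energy balance in the weak NESS: `totalCurrent(μ_δ)/δ = (L−1)γ(1/2 − ⟨k_0⟩_δ/δ)` for `0 < |δ| < δ₀`
  have hball : ∀ᶠ δ in 𝓝 (0 : ℝ), |δ| < δ₀ := by
    have : Metric.ball (0 : ℝ) δ₀ ∈ 𝓝 (0 : ℝ) := Metric.ball_mem_nhds 0 hδ₀
    filter_upwards [this] with δ hδ
    simpa [Real.dist_eq] using hδ
  have hbal : ∀ᶠ δ in 𝓝[≠] (0 : ℝ),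
      ((L : ℝ) - 1) * γ * (1 / 2 - (∫ y, k y ∂(μf δ)) / δ) = P.totalCurrent (μf δ) / δ := by
    filter_upwards [hball.filter_mono nhdsWithin_le_nhds, self_mem_nhdsWithin] with δ hδ hδ0
    rw [Set.mem_compl_iff, Set.mem_singleton_iff] at hδ0
    obtain ⟨hTL, hTR, hϑ'⟩ := bath_facts_of_abs_lt hδ₀T hϑT hδ
    haveI := (hfacts δ hδ).1
    have hss : P.IsSteadyState L (T + δ / 2) (T - δ / 2) (μf δ) := hμ L _ _ hTL hTR
    have hflip : P.IsFlipSteadyState L (T + δ / 2) (T - δ / 2) 0 (μf δ) :=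
      (P.isFlipSteadyState_zero_iff L _ _ (μf δ)).2 hss
    have htc := VanishingNoiseBound.totalCurrent_eq_left hω hl.le hβ.le hγ hL hTL.le hTR.le hflip
    have hkint : Integrable k (μf δ) :=
      integrable_of_abs_le_exp ((hfacts δ hδ).2.2 ϑ hϑ hϑ') hk2.continuous hkb
    have hp2 : ∫ x, x.2 ⟨0, hL⟩ ^ 2 ∂(μf δ) = (∫ y, k y ∂(μf δ)) + T := by
      have e : (fun x : PhaseSpace L => x.2 ⟨0, hL⟩ ^ 2) = fun x => k x + T := by
        funext x; simp [hk]
      rw [e, integral_add hkint (integrable_const T), integral_const, probReal_univ, one_smul]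
    rw [htc, hp2]
    field_simp
    ring
  have hlimJ : Tendsto (fun δ : ℝ => P.totalCurrent (μf δ) / δ) (𝓝[≠] 0)
      (𝓝 (((L : ℝ) - 1) * γ * (1 / 2 - γ / (2 * T ^ 2) * (A - B)))) :=
    ((hlimk.const_sub (1 / 2)).const_mul (((L : ℝ) - 1) * γ)).congr' hbal
  have hDL : D L = ((L : ℝ) - 1) * γ * (1 / 2 - γ / (2 * T ^ 2) * (A - B)) :=
    tendsto_nhds_unique hD hlimJ
  -- the row sum and the algebra
  have hrow : A + B = T ^ 2 / γ := stub_rowSum ω₂ lam β γ T hω hl hβ hγ hT L hL2 g hC hgL2 hmean hpde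
  have hBeq : B = T ^ 2 / γ - A := by linarith
  have hL1 : ((L : ℝ) - 1) ≠ 0 := by
    have : (2 : ℝ) ≤ (L : ℝ) := by exact_mod_cast hL2
    linarith
  rw [hDL, hBeq]
  field_simp
  ring

/-- **The Kubo link from UNIFORM MIXING** (stub `stub_kuboLink` of line `ForecastSensitivitySketch`,
second conditional form, the stub's signature VERBATIM behind one global analytic hypothesis `UM`): if for
all admissible parameters, every `T > 0` and every `N ≥ 2` the transition semigroups of the pinned chain with
baths at `T ± δ/2` converge exponentially fast in the `e^{ϑH}`-weighted norm with constants uniform in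
`|δ| < δ₀` (some `0 < δ₀ < 2T`, `0 < ϑ < 1/(T + δ₀/2)`, `2ϑ < 1/T` — CEHR 2018 (2.5) with `δ`-uniform Harris
constants; the binder `hUM` of route `OddSectorIrreversibility`'s `responseDensity_conclusion_of_hyps`), then
along the crux's unique weak steady-state family, for every `L ≥ 2` and every classical left forward field
`g`, `D_L/(L−1) = γ(1 − (γ/T²)⟨g, p_0² − T⟩_{μ_T})` (`stub_kuboLink_of_uniformMixingAt`). -/
theorem stub_kuboLink_of_uniformMixing :
    (∀ ω₂ lam β γ : ℝ, 0 < ω₂ → 0 < lam → 0 < β → 0 < γ → ∀ T : ℝ, 0 < T → ∀ N : ℕ, 2 ≤ N → ∃ (δ₀ ϑ Cm c : ℝ), 0 < δ₀ ∧ δ₀ < 2 * T ∧ 0 < ϑ ∧ ϑ < 1 / (T + δ₀ / 2) ∧ 2 * ϑ < 1 / T ∧ 0 ≤ Cm ∧ 0 < c ∧ ∀ δ : ℝ, |δ| < δ₀ → ∀ ν : Measure (PhaseSpace N), IsProbabilityMeasure ν → (∀ t : NNReal, ν.bind ((pinnedChain ω₂ lam β γ).transitionKernel N (T + δ / 2)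 (T - δ / 2) t) = ν) → ∀ (z : PhaseSpace N) (t : NNReal) (f : PhaseSpace N → ℝ), Continuous f → (∀ y, |f y| ≤ Real.exp (ϑ * (pinnedChain ω₂ lam β γ).hamiltonian N y)) → |(∫ y, f y ∂((pinnedChain ω₂ lam β γ).transitionKernel N (T + δ / 2) (T - δ / 2) t z)) - ∫ y, f y ∂ν| ≤ Cm * Real.exp (ϑ * (pinnedChain ω₂ lam β γ).hamiltonian N z) * Real.exp (-c * t)) → ∀ (ω₂ lam β γ : ℝ) (μ : (N : ℕ) → ℝ → ℝ → Measure (PhaseSpace N)) (T : ℝ) (D : ℕ → ℝ), 0 < ω₂ → 0 < lam → 0 < β → 0 < γ → 0 < T → (∀ (N : ℕ) (T_L T_R : ℝ), 0 < T_L → 0 < T_R → ∀ ρ ρ' : Measure (PhaseSpace N), (pinnedChain ω₂ lam β γ).IsSteadyState N T_L T_R ρ → (pinnedChain ω₂ lam β γ).IsSteadyState N T_L T_R ρ' → ρ = ρ') → (∀ (N : ℕ) (T_L T_R : ℝ), 0 < T_L → 0 < T_R → (pinnedChain ω₂ lam β γ).IsSteadyState N T_L T_R (μ N T_L T_R)) →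 (∀ N : ℕ, Tendsto (fun δ : ℝ => (pinnedChain ω₂ lam β γ).totalCurrent (μ N (T + δ / 2) (T - δ / 2)) / δ) (𝓝[≠] 0) (𝓝 (D N))) → ∀ L : ℕ, 2 ≤ L → ∀ g : PhaseSpace L → ℝ, ContDiff ℝ 2 g → MemLp g 2 ((pinnedChain ω₂ lam β γ).gibbsMeasure L T) → ∫ x, g x ∂((pinnedChain ω₂ lam β γ).gibbsMeasure L T) = 0 → (∀ x, (pinnedChain ω₂ lam β γ).generator L T T g x = -(kin L 0 x - T)) → D L / ((L : ℝ) - 1) = γ * (1 - γ / T ^ 2 * ∫ x, g x * (kin L 0 x - T) ∂((pinnedChain ω₂ lam β γ).gibbsMeasure L T)) := by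
  intro hUMall ω₂ lam β γ μ T D hω hl hβ hγ hT hU hμ hD L hL2 g hC hgL2 hmean hpde
  obtain ⟨δ₀, ϑ, Cm, c, hδ₀, hδ₀T, hϑ, hϑT, h2ϑ, hCm, hc, hUM⟩ := hUMall ω₂ lam β γ hω hl hβ hγ T hT L hL2
  exact stub_kuboLink_of_uniformMixingAt μ D hω hl hβ hγ hT hU hμ hL2 (hD L) hδ₀ hδ₀T hϑ hϑT h2ϑ hCm hc
    hUM hC hgL2 hmean hpde

end NESS

end Summit.AtomisticToContinuum.FouriersLaw.Cruxes.ConductanceLowerBound.ForecastSensitivity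

end
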